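import Literature.Probability.Percolation.KozmaNitzanSeparatingTriple
import HarnessLib

/-!
# Two-cuts with the root and one target on the root side (MODE B), V: the near lemma — the merge bracket with a bystander

Support file for the Sahi programme (`--supports stmt-CriticalPhenomena-4575`, prover prim-sahi-p2 gen 26).  No definitions, no named
facts, no sorries; standard axioms.  Memo `run/shared/lean/prim/prim-sahi/FROM-prim-sahi-p2-gen26-NEAR-LEMMA.md` §3 (Step B, "merge").

Bond percolation `μ = prodBernoulli w` on a finite vertex type; ports `x, y`, a bystander `s` (the root of the near side) and a target `a`.
With `R = {x ↮ s} ∩ {y ↮ s}` (the port pair avoids the bystander), `M = {x ↔ a} ∪ {y ↔ a}` (`a` joins the port pair) and `{x ↔ y}`: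

  `μ(R ∩ {x ↔ y}) · μ(R ∩ M) ≤ μ(R) · μ(R ∩ {x ↔ y} ∩ M)`                                  (`near_merge_bystander`)

i.e. `P(a ∈ C_x | x ↔ y, x ↮ s) ≥ P(a ∈ C_x ∪ C_y | x, y, s pairwise separated)` — the cluster-merge inequality of the tree
(`clusterMerge`, Ahlswede–Daykin) in the presence of a vertex `s` that must be avoided on both sides.  It is the positive correlation,
given `{S ↮ s}` for the ROOT SET `S = {x, y}`, of the two increasing functions of the union of open edge clusters `C_S`
"`x ↔ y` inside `C_S`" and "`a ∈ C_S`": an instance of van den Berg–Häggström–Kahn 2006, Thm 1.3 with a set of sources (Remark 1;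
Thm 2.1 at `q = 1`), in the tree `BHK2006_setClusterConditionalPositiveAssociation`.  This is the bracket that makes the Harris rows of
the near lemma (N⁺) of THEOREM B⁺ close (`IncStarTwoCut.near_R0_nonneg`, part III).
-/

noncomputable section

namespace Summit.CriticalPhenomena.PercolationContinuityZ3.Theorems

namespace IncStarTwoCut

open MeasureTheory Set Literature.Probability.Percolation Literature.Probability.LatticeModels
open scoped Classical

variable {V : Type*} [Fintype V]

/-- **Merge with a bystander.**  For vertices `x, y, s, a`, `R = {ω | ∀ u ∈ {x,y}, ∀ t ∈ {s}, u ↮ t}`, `M = ⋃_{u ∈ {x,y}} {u ↔ a}`: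
`μ(R ∩ {x ↔ y}) · μ(R ∩ M) ≤ μ(R) · μ(R ∩ ({x ↔ y} ∩ M))`.  BHK 2006 Thm 1.3 for the source set `{x, y}` and the avoided vertex `s`,
applied to the monotone functions `C ↦ 1{(openGraph C).Reachable x y}` and `C ↦ 1{a ∈ {x,y} ∨ ∃ e ∈ C, a ∈ e}` of `C = C_{{x,y}}`.
[cite: VandenbergHaggstromKahn2005, Thm. 1.3 (p. 6) and Remark 1 (p. 5); Thm. 2.1 (p. 9) at q = 1 — instance] -/
theorem near_merge_bystander (w : Sym2 V → unitInterval) (x y s a : V) :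
    (prodBernoulli w).real ({ω : BondConfig V | ∀ u ∈ ({x, y} : Set V), ∀ t ∈ ({s} : Set V), ¬ (openGraph ω).Reachable u t} ∩
          openConn x y) *
        (prodBernoulli w).real ({ω : BondConfig V | ∀ u ∈ ({x, y} : Set V), ∀ t ∈ ({s} : Set V), ¬ (openGraph ω).Reachable u t} ∩
          ⋃ u ∈ ({x, y} : Set V), openConn u a) ≤
      (prodBernoulli w).real {ω : BondConfig V | ∀ u ∈ ({x, y} : Set V), ∀ t ∈ ({s} : Set V), ¬ (openGraph ω).Reachable u t} *
        (prodBernoulli w).real ({ω : BondConfig V | ∀ u ∈ ({x, y} : Set V), ∀ t ∈ ({s} : Set V), ¬ (openGraph ω).Reachable u t} ∩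
          (openConn x y ∩ ⋃ u ∈ ({x, y} : Set V), openConn u a)) := by
  set S : Set V := {x, y} with hS
  set D : Set (BondConfig V) := {ω | ∀ u ∈ S, ∀ t ∈ ({s} : Set V), ¬ (openGraph ω).Reachable u t} with hD
  -- the two monotone functions of the union cluster
  let F : Set (Sym2 V) → ℝ := fun C => if (openGraph C).Reachable x y then 1 else 0
  let G : Set (Sym2 V) → ℝ := fun C => if (a ∈ S ∨ ∃ e ∈ C, a ∈ e) then 1 else 0
  have hF : Monotone F := by
    intro C C' h
    simp only [F]
    by_cases hc : (openGraph C).Reachable x y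
    · rw [if_pos hc, if_pos (hc.mono (openGraph_mono h))]
    · rw [if_neg hc]; split_ifs <;> norm_num
  have hG : Monotone G := by
    intro C C' h
    simp only [G]
    by_cases hc : a ∈ S ∨ ∃ e ∈ C, a ∈ e
    · rw [if_pos hc, if_pos (hc.imp_right fun ⟨e, he, hae⟩ => ⟨e, h he, hae⟩)]
    · rw [if_neg hc]; split_ifs <;> norm_num
  have key := BHK2006_setClusterConditionalPositiveAssociation w S ({s} : Set V) F G hF hG
  -- identify the integrands with indicators of events
  have hx : x ∈ S := by simp [hS]
  have eF : ∀ ω : BondConfig V, F (⋃ u ∈ S, openEdgeCluster ω u) = (openConn x y).indicator 1 ω := by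
    intro ω
    simp only [F]
    rw [← KNSep.reachable_iff_cluster ω S hx y]
    exact TwoSetConditionalAssociation.predIndicator_eq_indicator (fun ω' => (openGraph ω').Reachable x y) ω
  have eG : ∀ ω : BondConfig V, G (⋃ u ∈ S, openEdgeCluster ω u) = (⋃ u ∈ S, openConn u a).indicator 1 ω := by
    intro ω
    simp only [G]
    rw [← TwoSetConditionalAssociation.setOf_mem_or_exists_mem_biUnion_openEdgeCluster S a]
    exact TwoSetConditionalAssociation.predIndicator_eq_indicator
      (fun ω' => a ∈ S ∨ ∃ e ∈ ⋃ u ∈ S, openEdgeCluster ω' u, a ∈ e) ω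
  have eFG : ∀ ω : BondConfig V, F (⋃ u ∈ S, openEdgeCluster ω u) * G (⋃ u ∈ S, openEdgeCluster ω u)
      = (openConn x y ∩ ⋃ u ∈ S, openConn u a).indicator 1 ω := by
    intro ω
    rw [eF, eG]
    exact (congrFun (Set.inter_indicator_one (s := openConn x y) (t := ⋃ u ∈ S, openConn u a) (M₀ := ℝ)) ω).symm
  simp only [eF, eG] at key
  rw [show (fun ω : BondConfig V => (openConn x y).indicator (1 : BondConfig V → ℝ) ω *
        (⋃ u ∈ S, openConn u a).indicator 1 ω) = fun ω => (openConn x y ∩ ⋃ u ∈ S, openConn u a).indicator 1 ω from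
      funext fun ω => by rw [← eF ω, ← eG ω]; exact eFG ω] at key
  rw [TripodExchange.setIntegral_indicator_one_eq, TripodExchange.setIntegral_indicator_one_eq,
    TripodExchange.setIntegral_indicator_one_eq] at key
  exact key

omit [Fintype V] in
/-- The avoidance event of the merge bracket in plain form: `{∀ u ∈ {x,y}, ∀ t ∈ {s}, u ↮ t} = {x ↮ s} ∩ {y ↮ s}`. [folklore] -/
theorem portPair_avoid_eq (x y s : V) :
    {ω : BondConfig V | ∀ u ∈ ({x, y} : Set V), ∀ t ∈ ({s} : Set V), ¬ (openGraph ω).Reachable u t}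
      = (openConn x s)ᶜ ∩ (openConn y s)ᶜ := by
  ext ω
  simp only [mem_setOf_eq, mem_insert_iff, mem_singleton_iff, forall_eq_or_imp, forall_eq, mem_inter_iff, mem_compl_iff, openConn]

omit [Fintype V] in
/-- The attachment event of the merge bracket in plain form: `⋃_{u ∈ {x,y}} {u ↔ a} = {x ↔ a} ∪ {y ↔ a}`. [folklore] -/
theorem portPair_attach_eq (x y a : V) :
    (⋃ u ∈ ({x, y} : Set V), openConn u a : Set (BondConfig V)) = openConn x a ∪ openConn y a := by
  ext ω
  simp only [mem_iUnion, mem_insert_iff, mem_singleton_iff, exists_prop, mem_union]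
  constructor
  · rintro ⟨u, (rfl | rfl), hu⟩
    · exact Or.inl hu
    · exact Or.inr hu
  · rintro (h | h)
    · exact ⟨x, Or.inl rfl, h⟩
    · exact ⟨y, Or.inr rfl, h⟩

/-- **Merge with a bystander, plain form** (memo §3): with `R = {x↮s} ∩ {y↮s}` and `M = {x↔a} ∪ {y↔a}`,
`μ(R ∩ {x↔y}) · μ(R ∩ M) ≤ μ(R) · μ(R ∩ ({x↔y} ∩ M))`.
[cite: VandenbergHaggstromKahn2005, Thm. 1.3 (p. 6) and Remark 1 (p. 5) — instance] -/
theorem near_merge_bystander' (w : Sym2 V → unitInterval) (x y s a : V) :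
    (prodBernoulli w).real ((openConn x s)ᶜ ∩ (openConn y s)ᶜ ∩ openConn x y : Set (BondConfig V)) *
        (prodBernoulli w).real ((openConn x s)ᶜ ∩ (openConn y s)ᶜ ∩ (openConn x a ∪ openConn y a) : Set (BondConfig V)) ≤
      (prodBernoulli w).real ((openConn x s)ᶜ ∩ (openConn y s)ᶜ : Set (BondConfig V)) *
        (prodBernoulli w).real ((openConn x s)ᶜ ∩ (openConn y s)ᶜ ∩ (openConn x y ∩ (openConn x a ∪ openConn y a)) :
          Set (BondConfig V)) := by
  have h := near_merge_bystander w x y s a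
  rw [portPair_avoid_eq, portPair_attach_eq] at h
  exact h

end IncStarTwoCut

end Summit.CriticalPhenomena.PercolationContinuityZ3.Theorems
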